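import Summits.HubbardSuperconductivity.HubbardSuperconductivity.Theorems.LevyLogBootstrapDressHalfFilledInterBonds
import Literature.MathematicalPhysics.QuantumLattice.InterClusterKernelHopVectors
import HarnessLib

/-!
# Route `LevyLogBootstrap` / `AnisotropyChord`, crux `DressHalfFilled` (stmt-HubbardSuperconductivity-8148), stub 2
# `stub_plaquetteDictionary`, clause (d) — the inter-plaquette HOPPING as a sum over oriented superlattice bonds

Support file (`--supports stmt-HubbardSuperconductivity-8148`), continuing `…DressHalfFilledInterBonds` (the bond
geometry `interGraph_adj_plaqSite_iff`). The inter-plaquette hopping of the checkerboard Hubbard torus of side `2M`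
at `t' = 1`, `T = hamiltonian G_inter 1 0` with `G_inter = fermionTorusGraph 2 (2M) ⊓ SimpleGraph.comap (block map) ⊤`,
is by definition `-Σ_{x ∼ y, σ} c†_{xσ} c_{yσ}` over ORDERED adjacent pairs (`hamiltonian_one_zero`). Reindexing the
darts of `G_inter` by (plaquette `R`, direction `k`, boundary bond `q ∈ ![plaquetteBonds, plaquetteBondsV] k`,
orientation) — `sum_ite_interGraph_adj_eq`, valid for any summand `F x y`, with the pair-indicator bookkeeping
`sum_sum_ite_mem_eq_sum` of `InterClusterKernelHopVectors` — gives

  `T = -Σ_R Σ_k Σ_{q} Σ_σ (c†_{(2R + q.1)σ} c_{(2(R+e_k) + q.2)σ} + c†_{(2(R+e_k) + q.2)σ} c_{(2R + q.1)σ})`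

(`hamiltonian_inter_eq_bondSum`, `M ≥ 2`), i.e. `T = Σ_{(R,k)} T_{R,k}` with `T_{R,k}` the embedded two-plaquette
hopping `-Σ_{(p,q) ∈ bonds_k, σ} (c†_{pσ} c_{qσ} + h.c.)` of `PlaquettePairCouplings` — the form in which Kato's kernel
`T S(E₀) T` is evaluated bond by bond (`…KernelXXZBondSum`). The registered sub-goal
`dressHalfFilled_interHoppingBondSum` (signature verbatim as registered on the item) is the closed form.

References: H. Yao, W.-F. Tsai, S. A. Kivelson, PRB 76 (2007) 161104(R), eq. (1), Fig. 1 [YaoTsaiKivelson2007];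
W.-F. Tsai, S. A. Kivelson, PRB 73 (2006) 214510, §I, App. A [TsaiKivelson2006]. No definition and no named fact is
introduced; all statements are [folklore] bookkeeping.
-/

set_option linter.dupNamespace false

noncomputable section

namespace Summit.HubbardSuperconductivity.HubbardSuperconductivity.Theorems.LevyLogBootstrap

open Literature.MathematicalPhysics.QuantumLattice Literature.Probability.LatticeModels
open Literature.MathematicalPhysics.QuantumLattice.TorusPlaquette

/-! ### Generic finite-sum bookkeeping -/

section Generic

/-- The indicator of an EXCLUSIVE finite disjunction `P ↔ ∃ k, A k ∨ B k` (at most one of the `A k`, `B k` holds) is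
the sum of the indicators. [folklore] -/
theorem ite_eq_sum_ite_add_ite {ι γ : Type*} [Fintype ι] [AddCommMonoid γ] (P : Prop) [Decidable P]
    (A B : ι → Prop) [DecidablePred A] [DecidablePred B] (hP : P ↔ ∃ k, A k ∨ B k)
    (hAA : ∀ k k', A k → A k' → k = k') (hBB : ∀ k k', B k → B k' → k = k')
    (hAB : ∀ k k', A k → ¬B k') (x : γ) :
    (if P then x else 0) = ∑ k, ((if A k then x else 0) + if B k then x else 0) := by
  by_cases hp : P
  · rw [if_pos hp]
    obtain ⟨k, hk⟩ := hP.1 hp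
    rw [Fintype.sum_eq_single k]
    · rcases hk with hA | hB
      · rw [if_pos hA, if_neg (hAB k k hA), add_zero]
      · rw [if_neg (fun hA => hAB k k hA hB), if_pos hB, zero_add]
    · intro k' hk'
      rcases hk with hA | hB
      · rw [if_neg (fun hA' => hk' (hAA k' k hA' hA)), if_neg (hAB k k' hA), add_zero]
      · rw [if_neg (fun hA' => hAB k' k hA' hB), if_neg (fun hB' => hk' (hBB k' k hB' hB)), add_zero]
  · rw [if_neg hp]
    symm
    refine Finset.sum_eq_zero fun k _ => ?_
    rw [if_neg (fun hA => hp (hP.2 ⟨k, Or.inl hA⟩)), if_neg (fun hB => hp (hP.2 ⟨k, Or.inr hB⟩)), add_zero]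

/-- Rotate the innermost of five finite sums to the front. [folklore] -/
theorem sum5_rotate {α β γ δ ι ε : Type*} [Fintype α] [Fintype β] [Fintype γ] [Fintype δ] [Fintype ι]
    [AddCommMonoid ε] (G : α → β → γ → δ → ι → ε) :
    ∑ a, ∑ b, ∑ c, ∑ d, ∑ k, G a b c d k = ∑ k, ∑ a, ∑ b, ∑ c, ∑ d, G a b c d k := by
  calc ∑ a, ∑ b, ∑ c, ∑ d, ∑ k, G a b c d k
      = ∑ a, ∑ b, ∑ c, ∑ k, ∑ d, G a b c d k :=
        Finset.sum_congr rfl fun a _ => Finset.sum_congr rfl fun b _ => Finset.sum_congr rfl fun c _ =>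
          Finset.sum_comm
    _ = ∑ a, ∑ b, ∑ k, ∑ c, ∑ d, G a b c d k :=
        Finset.sum_congr rfl fun a _ => Finset.sum_congr rfl fun b _ => Finset.sum_comm
    _ = ∑ a, ∑ k, ∑ b, ∑ c, ∑ d, G a b c d k := Finset.sum_congr rfl fun a _ => Finset.sum_comm
    _ = ∑ k, ∑ a, ∑ b, ∑ c, ∑ d, G a b c d k := Finset.sum_comm

/-- Exchange the first pair of four finite sums with the second pair. [folklore] -/
theorem sum4_swap_pairs {α β γ δ ε : Type*} [Fintype α] [Fintype β] [Fintype γ] [Fintype δ] [AddCommMonoid ε]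
    (G : α → β → γ → δ → ε) :
    ∑ a, ∑ b, ∑ c, ∑ d, G a b c d = ∑ c, ∑ d, ∑ a, ∑ b, G a b c d := by
  calc ∑ a, ∑ b, ∑ c, ∑ d, G a b c d
      = ∑ a, ∑ c, ∑ b, ∑ d, G a b c d := Finset.sum_congr rfl fun a _ => Finset.sum_comm
    _ = ∑ c, ∑ a, ∑ b, ∑ d, G a b c d := Finset.sum_comm
    _ = ∑ c, ∑ a, ∑ d, ∑ b, G a b c d :=
        Finset.sum_congr rfl fun c _ => Finset.sum_congr rfl fun a _ => Finset.sum_comm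
    _ = ∑ c, ∑ d, ∑ a, ∑ b, G a b c d := Finset.sum_congr rfl fun c _ => Finset.sum_comm

/-- A pinned first index and a filtered second index: `Σ_{c'} Σ_d [c' = c ∧ Q d] g c' d = Σ_d [Q d] g c d`.
[folklore] -/
theorem sum_sum_ite_eq_and {α δ ε : Type*} [Fintype α] [DecidableEq α] [Fintype δ] [AddCommMonoid ε] (c : α)
    (Q : δ → Prop) [DecidablePred Q] (g : α → δ → ε) :
    ∑ c', ∑ d, (if c' = c ∧ Q d then g c' d else 0) = ∑ d, if Q d then g c d else 0 := by
  rw [Fintype.sum_eq_single c]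
  · refine Finset.sum_congr rfl fun d _ => ?_
    by_cases hQ : Q d
    · rw [if_pos ⟨rfl, hQ⟩, if_pos hQ]
    · rw [if_neg (fun h => hQ h.2), if_neg hQ]
  · intro c' hc'
    exact Finset.sum_eq_zero fun d _ => if_neg fun h => hc' h.1

/-- The Hubbard Hamiltonian at `t = 1`, `U = 0` is minus the sum of the hops along ORDERED adjacent pairs.
[folklore] -/
theorem hamiltonian_one_zero {Λ : Type*} [LinearOrder Λ] [Fintype Λ] (G : SimpleGraph Λ) [DecidableRel G.Adj] :
    hamiltonian G 1 0 = -∑ x, ∑ y, ∑ σ : Fin 2,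
      if G.Adj x y then creation (orb x σ) * annihilation (orb y σ) else 0 := by
  rw [hamiltonian, Complex.ofReal_one, Complex.ofReal_zero, zero_smul, add_zero, neg_smul, one_smul]

end Generic

/-! ### Sums over the sites and over the darts of the inter-plaquette graph -/

section Torus

variable {M : ℕ}

/-- Sums over the sites of the `2M`-torus, plaquette by plaquette: `Σ_x f x = Σ_R Σ_a f (2R + a)`. [folklore] -/
theorem sum_sites_eq_sum_plaqSite {γ : Type*} [AddCommMonoid γ] (f : FermionTorus 2 (2 * M) → γ) :
    ∑ x, f x = ∑ R : FermionTorus 2 M, ∑ a : PlaquetteSite, f (plaqSite M R a) := by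
  rw [← Fintype.sum_prod_type']
  refine (Fintype.sum_bijective (fun p : FermionTorus 2 M × PlaquetteSite => plaqSite M p.1 p.2) ⟨?_, ?_⟩ _ _
    (fun _ => rfl)).symm
  · rintro ⟨R, a⟩ ⟨R', b⟩ h
    have h' : plaqSite M R a = plaqSite M R' b := h
    have h1 : blockOf M (plaqSite M R a) = blockOf M (plaqSite M R' b) := by rw [h']
    have h2 : posOf M (plaqSite M R a) = posOf M (plaqSite M R' b) := by rw [h']
    rw [blockOf_plaqSite, blockOf_plaqSite] at h1
    rw [posOf_plaqSite, posOf_plaqSite] at h2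
    rw [h1, h2]
  · intro x
    exact ⟨(blockOf M x, posOf M x), plaqSite_blockOf_posOf M x⟩

set_option synthInstance.maxSize 1024 in
/-- The boundary bond sets are EXCLUSIVE: a pair of positions is a `k`-boundary bond for at most one direction `k`,
and never together with its transpose (kernel decision over the `2 × 2 × 4 × 4` cases). [folklore] -/
theorem plaquetteBonds_vec_exclusive : ∀ (k k' : Fin 2) (a b : PlaquetteSite),
    ((a, b) ∈ (![plaquetteBonds, plaquetteBondsV] : Fin 2 → Finset (PlaquetteSite × PlaquetteSite)) k →
      (a, b) ∈ (![plaquetteBonds, plaquetteBondsV] : Fin 2 → Finset (PlaquetteSite × PlaquetteSite)) k' →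
        k = k') ∧
    ((a, b) ∈ (![plaquetteBonds, plaquetteBondsV] : Fin 2 → Finset (PlaquetteSite × PlaquetteSite)) k →
      (b, a) ∉ (![plaquetteBonds, plaquetteBondsV] : Fin 2 → Finset (PlaquetteSite × PlaquetteSite)) k') := by
  decide

variable [NeZero M]

/-- **Sums over the darts of the inter-plaquette graph** (`M ≥ 2`): for any summand `F`,
`Σ_{x,y} [x ∼ y in G_inter] F x y = Σ_R Σ_k Σ_{q ∈ bonds_k} (F (2R + q.1) (2(R+e_k) + q.2) + F (2(R+e_k) + q.2) (2R + q.1))`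
— the darts are the oriented superlattice bonds `(R, R + e_k)` × the two boundary bonds × the two orientations
(`interGraph_adj_plaqSite_iff` + exclusivity). [cite: YaoTsaiKivelson2007, Fig. 1] -/
theorem sum_ite_interGraph_adj_eq (hM : 2 ≤ M) {γ : Type*} [AddCommMonoid γ]
    (F : FermionTorus 2 (2 * M) → FermionTorus 2 (2 * M) → γ) :
    (∑ x, ∑ y, if (fermionTorusGraph 2 (2 * M) ⊓ SimpleGraph.comap
        (fun x : FermionTorus 2 (2 * M) => fun i : Fin 2 => ((ofLex x) i : ℕ) / 2) ⊤).Adj x y then F x y else 0) =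
      ∑ R : FermionTorus 2 M, ∑ k : Fin 2,
        ∑ q ∈ (![plaquetteBonds, plaquetteBondsV] : Fin 2 → Finset (PlaquetteSite × PlaquetteSite)) k,
          (F (plaqSite M R q.1) (plaqSite M (plaqNbr R k) q.2) + F (plaqSite M (plaqNbr R k) q.2) (plaqSite M R q.1)) := by
  rw [sum_sites_eq_sum_plaqSite]
  simp_rw [sum_sites_eq_sum_plaqSite (M := M) (f := fun y => if _ then F _ y else 0)]
  -- the adjacency indicator as an exclusive sum over directions and orientations
  have h3 : ∀ (R : FermionTorus 2 M) (a : PlaquetteSite) (R' : FermionTorus 2 M) (b : PlaquetteSite),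
      (if (fermionTorusGraph 2 (2 * M) ⊓ SimpleGraph.comap
        (fun x : FermionTorus 2 (2 * M) => fun i : Fin 2 => ((ofLex x) i : ℕ) / 2) ⊤).Adj
          (plaqSite M R a) (plaqSite M R' b) then F (plaqSite M R a) (plaqSite M R' b) else 0) =
      ∑ k : Fin 2, ((if R' = plaqNbr R k ∧ (a, b) ∈ (![plaquetteBonds, plaquetteBondsV] : Fin 2 →
          Finset (PlaquetteSite × PlaquetteSite)) k then F (plaqSite M R a) (plaqSite M R' b) else 0) +
        if R = plaqNbr R' k ∧ (b, a) ∈ (![plaquetteBonds, plaquetteBondsV] : Fin 2 →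
          Finset (PlaquetteSite × PlaquetteSite)) k then F (plaqSite M R a) (plaqSite M R' b) else 0) := by
    intro R a R' b
    refine ite_eq_sum_ite_add_ite _
      (fun k => R' = plaqNbr R k ∧ (a, b) ∈ (![plaquetteBonds, plaquetteBondsV] : Fin 2 →
          Finset (PlaquetteSite × PlaquetteSite)) k)
      (fun k => R = plaqNbr R' k ∧ (b, a) ∈ (![plaquetteBonds, plaquetteBondsV] : Fin 2 →
          Finset (PlaquetteSite × PlaquetteSite)) k) (interGraph_adj_plaqSite_iff hM R R' a b) ?_ ?_ ?_ _
    · exact fun k k' h h' => (plaquetteBonds_vec_exclusive k k' a b).1 h.2 h'.2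
    · exact fun k k' h h' => (plaquetteBonds_vec_exclusive k k' b a).1 h.2 h'.2
    · exact fun k k' h h' => (plaquetteBonds_vec_exclusive k k' a b).2 h.2 h'.2
  simp_rw [h3]
  rw [sum5_rotate]
  conv_rhs => rw [Finset.sum_comm]
  refine Finset.sum_congr rfl fun k _ => ?_
  simp only [Finset.sum_add_distrib]
  congr 1
  · -- forward darts `(2R + a, 2(R + e_k) + b)`: pin `R' = R + e_k`
    refine Finset.sum_congr rfl fun R _ => ?_
    exact (Finset.sum_congr rfl fun a _ => sum_sum_ite_eq_and (plaqNbr R k)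
      (fun b => (a, b) ∈ (![plaquetteBonds, plaquetteBondsV] : Fin 2 → Finset (PlaquetteSite × PlaquetteSite)) k)
      (fun R' b => F (plaqSite M R a) (plaqSite M R' b))).trans
      (sum_sum_ite_mem_eq_sum _ fun a b => F (plaqSite M R a) (plaqSite M (plaqNbr R k) b))
  · -- backward darts `(2(R' + e_k) + a, 2R' + b)`: bring `R'` to the front and pin `R = R' + e_k`
    rw [sum4_swap_pairs]
    refine Finset.sum_congr rfl fun R' _ => ?_
    exact (Finset.sum_congr rfl fun b _ => sum_sum_ite_eq_and (plaqNbr R' k)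
      (fun a => (b, a) ∈ (![plaquetteBonds, plaquetteBondsV] : Fin 2 → Finset (PlaquetteSite × PlaquetteSite)) k)
      (fun R a => F (plaqSite M R a) (plaqSite M R' b))).trans
      (sum_sum_ite_mem_eq_sum _ fun b a => F (plaqSite M (plaqNbr R' k) a) (plaqSite M R' b))

/-- **The inter-plaquette hopping as a sum over oriented superlattice bonds** (`M ≥ 2`):
`hamiltonian G_inter 1 0 = -Σ_R Σ_k Σ_{q ∈ bonds_k} Σ_σ (c†_{(2R+q.1)σ} c_{(2(R+e_k)+q.2)σ} + h.c.)`.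
[cite: YaoTsaiKivelson2007, eq. (1)] -/
theorem hamiltonian_inter_eq_bondSum (hM : 2 ≤ M) :
    hamiltonian (fermionTorusGraph 2 (2 * M) ⊓ SimpleGraph.comap
        (fun x : FermionTorus 2 (2 * M) => fun i : Fin 2 => ((ofLex x) i : ℕ) / 2) ⊤) 1 0 =
      -∑ R : FermionTorus 2 M, ∑ k : Fin 2,
        ∑ q ∈ (![plaquetteBonds, plaquetteBondsV] : Fin 2 → Finset (PlaquetteSite × PlaquetteSite)) k,
          ∑ σ : Fin 2,
            (creation (orb (plaqSite M R q.1) σ) * annihilation (orb (plaqSite M (plaqNbr R k) q.2) σ) +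
              creation (orb (plaqSite M (plaqNbr R k) q.2) σ) * annihilation (orb (plaqSite M R q.1) σ)) := by
  rw [hamiltonian_one_zero]
  simp_rw [Finset.sum_ite_irrel, Finset.sum_const_zero]
  rw [sum_ite_interGraph_adj_eq hM (fun x y => ∑ σ : Fin 2, creation (orb x σ) * annihilation (orb y σ))]
  refine congrArg Neg.neg ?_
  refine Finset.sum_congr rfl fun R _ => Finset.sum_congr rfl fun k _ => Finset.sum_congr rfl fun q _ => ?_
  exact Finset.sum_add_distrib.symm

end Torus

/-! ### Registered form -/

set_option linter.style.longLine false in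
/-- **Registered sub-goal `dressHalfFilled_interHoppingBondSum`** (closed form, signature verbatim as registered on
the crux item stmt-HubbardSuperconductivity-8148): the inter-plaquette hopping `T` (`t' = 1`) of the `2M × 2M`
checkerboard torus, `M ≥ 2`, equals minus the sum over oriented superlattice bonds `(R, k)`, bond pairs
`q ∈ ![plaquetteBonds, plaquetteBondsV] k` and spins of `c†_{(R,q.1)σ} c_{(R+e_k,q.2)σ} + h.c.`.
[cite: YaoTsaiKivelson2007, eq. (1)] -/
theorem dressHalfFilled_interHoppingBondSum : ∀ {M : ℕ} [NeZero M], 2 ≤ M → Literature.MathematicalPhysics.QuantumLattice.hamiltonian (Literature.MathematicalPhysics.QuantumLattice.fermionTorusGraph 2 (2 * M) ⊓ SimpleGraph.comap (fun x : Literature.MathematicalPhysics.QuantumLattice.FermionTorus 2 (2 * M) => fun i : Fin 2 => ((ofLex x) i : ℕ) / 2) ⊤) 1 0 = -∑ R : Literature.MathematicalPhysics.QuantumLattice.FermionTorus 2 M, ∑ k : Fin 2, ∑ q ∈ (![Literature.MathematicalPhysics.QuantumLattice.plaquetteBonds, Summit.HubbardSuperconductivity.HubbardSuperconductivity.Theorems.LevyLogBootstrap.plaquetteBondsV]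 : Fin 2 → Finset (Literature.MathematicalPhysics.QuantumLattice.PlaquetteSite × Literature.MathematicalPhysics.QuantumLattice.PlaquetteSite)) k, ∑ σ : Fin 2, (Literature.MathematicalPhysics.QuantumLattice.creation (Literature.MathematicalPhysics.QuantumLattice.orb (Literature.MathematicalPhysics.QuantumLattice.TorusPlaquette.plaqSite M R q.1) σ) * Literature.MathematicalPhysics.QuantumLattice.annihilation (Literature.MathematicalPhysics.QuantumLattice.orb (Literature.MathematicalPhysics.QuantumLattice.TorusPlaquette.plaqSite M (Summit.HubbardSuperconductivity.HubbardSuperconductivity.Theorems.LevyLogBootstrap.plaqNbr R k) q.2) σ) + Literature.MathematicalPhysics.QuantumLattice.creation (Literature.MathematicalPhysics.QuantumLattice.orb (Literature.MathematicalPhysics.QuantumLattice.TorusPlaquette.plaqSite M (Summit.HubbardSuperconductivity.HubbardSuperconductivity.Theorems.LevyLogBootstrap.plaqNbr R k) q.2) σ) * Literature.MathematicalPhysics.QuantumLattice.annihilation (Literature.MathematicalPhysics.QuantumLattice.orb (Literature.MathematicalPhysics.QuantumLattice.TorusPlaquette.plaqSite M R q.1) σ)) :=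
  fun hM => hamiltonian_inter_eq_bondSum hM

end Summit.HubbardSuperconductivity.HubbardSuperconductivity.Theorems.LevyLogBootstrap

end
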